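import Mathlib
import Summits.Ventures.HodgeRepro2.T5RamifiedBreak

/-!
# Above the break: `U_F^{(i)} ⊆ N(E^×)`, hence `f(η_v) ≤ i` (T5RamifiedNormAbove)

Setting as T5RamifiedBreak: `K_v ⊆ L_w` ramified quadratic, `π`, `σ ≠ 1`, `v(σ π − π) = exp(−i)` (`i ≥ 1`),
`v(2) = exp(−e)` in `K_v`, `τ = Tr π`, `ν = N π`.

ONE STEP (Serre, Local Fields V §3 Prop. 5 (iii) for a quadratic extension, made explicit): for `n ≥ i` and
`y = 1 + a ∈ U_F^{(n)}` put `x := alg c · π` with `c = a / τ` (Case A, `v(alg τ) = exp(−i)`) or `x := alg c` with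
`c = a / 2` (Case B, `i = 2e + 1`). Then `N(1 + x) = 1 + c τ_x + c² ν_x = y + c² ν_x` with `v(c² ν_x) ≤ exp(−(n + 1))`,
so `y · N(1 + x)⁻¹ ∈ U_F^{(n + 1)}`. FINITELY MANY STEPS reach level `2e + 1`, where every element is a norm
(row 155: `u ≡ 1 (mod 4 𝔪)` is a square) — no completeness argument is needed. Hence `U_F^{(i)} ⊆ N(L_w^×)` and the
conductor exponent `f = normCharConductor` (row 169) satisfies **`f ≤ i`**.
-/

namespace Summit.Ventures.HodgeRepro2.T5RamifiedNormAbove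

open IsDedekindDomain HeightOneSpectrum
open Summit.Ventures.HodgeRepro2.T5RamifiedIntegralBasis Summit.Ventures.HodgeRepro2.T5RamifiedBreak
open Summit.Ventures.HodgeRepro2.T5NormCharConductor

variable {K : Type*} [Field K] [NumberField K] (v : HeightOneSpectrum (NumberField.RingOfIntegers K))
  {L : Type*} [Field L] [NumberField L] [Algebra K L] (w : HeightOneSpectrum (NumberField.RingOfIntegers L))
  [w.asIdeal.LiesOver v.asIdeal]

noncomputable section

/-! ### The abstract one-step descent -/

/-- ONE STEP, abstractly: if `y − 1 = c τ₀` where `alg τ₀ = z₀ + σ z₀`, `alg ν₀ = z₀ σ z₀`, and `v(c² ν₀) ≤ exp(−(n+1))`,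
then the norm `z = N(1 + alg c z₀) = y + c² ν₀` is a unit in the norm group with `y z⁻¹ ∈ U^{(n+1)}`. -/
theorem exists_mem_normGroup_mul_inv_mem_of_eq
    (σ : (w.adicCompletion L) ≃ₐ[v.adicCompletion K] (w.adicCompletion L))
    {ϖ : v.adicCompletionIntegers K} (hϖ : Irreducible ϖ)
    (c : v.adicCompletion K) (z₀ : w.adicCompletion L) {τ₀ ν₀ : v.adicCompletion K}
    (hτ : algebraMap (v.adicCompletion K) (w.adicCompletion L) τ₀ = z₀ + σ z₀)
    (hν : algebraMap (v.adicCompletion K) (w.adicCompletion L) ν₀ = z₀ * σ z₀)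
    {n : ℕ} (y : (v.adicCompletion K)ˣ) (hy : Valued.v (y : v.adicCompletion K) = 1)
    (hyc : (y : v.adicCompletion K) - 1 = c * τ₀)
    (hc : Valued.v (c ^ 2 * ν₀) ≤ WithZero.exp (-((n + 1 : ℕ) : ℤ))) :
    ∃ z ∈ T5AdicCompletionNormGroup.normGroup v w σ, y * z⁻¹ ∈ unitFiltration v ϖ (n + 1) := by
  have hsmall : Valued.v (c ^ 2 * ν₀) < Valued.v (y : v.adicCompletion K) := by
    rw [hy]
    refine lt_of_le_of_lt hc ?_
    rw [← WithZero.exp_zero]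
    exact WithZero.exp_lt_exp.mpr (by omega)
  have hzval : Valued.v ((y : v.adicCompletion K) + c ^ 2 * ν₀) = 1 := by
    rw [Valuation.map_add_eq_of_lt_left _ hsmall, hy]
  have hz0 : (y : v.adicCompletion K) + c ^ 2 * ν₀ ≠ 0 := by
    intro h
    rw [h, map_zero] at hzval
    exact zero_ne_one hzval
  set z : (v.adicCompletion K)ˣ := Units.mk0 _ hz0 with hz
  have hzcoe : (z : v.adicCompletion K) = (y : v.adicCompletion K) + c ^ 2 * ν₀ := rfl
  refine ⟨z, ?_, ?_⟩
  · apply mem_normGroup_of_eq v w σ c z₀ hτ hν z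
    rw [hzcoe]
    linear_combination hyc
  · apply mem_unitFiltration_of_val_sub_one_le v hϖ
    · rw [Units.val_mul, Units.val_inv_eq_inv_val, map_mul, map_inv₀, hy, hzcoe, hzval]
      simp
    · have hzne : (z : v.adicCompletion K) ≠ 0 := z.ne_zero
      have : ((y * z⁻¹ : (v.adicCompletion K)ˣ) : v.adicCompletion K) - 1 =
          -(c ^ 2 * ν₀) / (z : v.adicCompletion K) := by
        rw [Units.val_mul, Units.val_inv_eq_inv_val]
        field_simp
        rw [hzcoe]
        ring
      rw [this, map_div₀, Valuation.map_neg, hzcoe, hzval, div_one]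
      exact hc

/-! ### Level `2e + 1` (row 155) -/

/-- Level `2e + 1` and beyond lies in the norm group (row 155: `v(y − 1) < v(4) = exp(−2e)`). -/
theorem unitFiltration_le_normGroup_of_two_mul_add_one_le
    {ϖ : v.adicCompletionIntegers K} (hϖ : Irreducible ϖ)
    (σ : (w.adicCompletion L) ≃ₐ[v.adicCompletion K] (w.adicCompletion L))
    (e : ℕ) (he : Valued.v (2 : v.adicCompletion K) = WithZero.exp (-(e : ℤ)))
    {n : ℕ} (hn : 2 * e + 1 ≤ n) :
    unitFiltration v ϖ n ≤ T5AdicCompletionNormGroup.normGroup v w σ := by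
  intro y hy
  apply T5NormGroupOpen.mem_normGroup_of_val_sub_one_lt_val_four
  have h4 : Valued.v (4 : v.adicCompletion K) = WithZero.exp (-(2 * e : ℤ)) := by
    have : (4 : v.adicCompletion K) = 2 ^ 2 := by norm_num
    rw [this, map_pow, he, sq, ← WithZero.exp_add]
    congr 1
    ring
  rw [h4]
  calc Valued.v ((y : v.adicCompletion K) - 1) ≤ WithZero.exp (-(n : ℤ)) :=
        val_sub_one_le_of_mem_unitFiltration v hϖ hy
    _ < WithZero.exp (-(2 * e : ℤ)) := WithZero.exp_lt_exp.mpr (by omega)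

/-! ### The valuations of `τ = Tr π`, `ν = N π` -/

section Ramified

variable [ContinuousSMul (v.adicCompletion K) (w.adicCompletion L)]
  [IsScalarTower K (v.adicCompletion K) (w.adicCompletion L)]

/-- `v(ν) = exp(−1)` for `alg ν = π σ π`. -/
theorem val_norm_uniformizer (h2 : Module.finrank (v.adicCompletion K) (w.adicCompletion L) = 2)
    {ϖ : v.adicCompletionIntegers K} (hϖ : Irreducible ϖ) {π : w.adicCompletionIntegers L} (hπ : Irreducible π)
    (hram : ¬ Irreducible (algebraMap (v.adicCompletionIntegers K) (w.adicCompletionIntegers L) ϖ))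
    (σ : (w.adicCompletion L) ≃ₐ[v.adicCompletion K] (w.adicCompletion L)) {ν : v.adicCompletion K}
    (hν : algebraMap (v.adicCompletion K) (w.adicCompletion L) ν = (π : w.adicCompletion L) * σ π) :
    Valued.v ν = WithZero.exp (-1) := by
  have hval : Valued.v (algebraMap (v.adicCompletion K) (w.adicCompletion L) ν) = WithZero.exp (-2) := by
    rw [hν, map_mul, T5AdicCompletionGaloisInvariance.val_algEquiv_apply,
      T5AdicCompletionNormGroup.val_uniformizer w hπ, ← WithZero.exp_add]
    norm_num
  have hν0 : ν ≠ 0 := by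
    rintro rfl
    rw [map_zero, map_zero] at hval
    exact (WithZero.exp_ne_zero hval.symm)
  rw [val_algebraMap_eq_exp_two_mul_log v w h2 hϖ hπ hram hν0] at hval
  have := WithZero.exp_injective hval
  have h0 : Valued.v ν ≠ 0 := (Valuation.ne_zero_iff _).mpr hν0
  rw [← WithZero.exp_log h0]
  congr 1
  omega

omit [IsScalarTower K (v.adicCompletion K) (w.adicCompletion L)] in
/-- Case A: `v(alg τ) = exp(−i)` ⇒ `v(τ) = exp(k)` with `2k = −i`. -/
theorem exists_val_trace_eq (h2 : Module.finrank (v.adicCompletion K) (w.adicCompletion L) = 2)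
    {ϖ : v.adicCompletionIntegers K} (hϖ : Irreducible ϖ) {π : w.adicCompletionIntegers L} (hπ : Irreducible π)
    (hram : ¬ Irreducible (algebraMap (v.adicCompletionIntegers K) (w.adicCompletionIntegers L) ϖ))
    {τ : v.adicCompletion K} {i : ℕ}
    (hτA : Valued.v (algebraMap (v.adicCompletion K) (w.adicCompletion L) τ) = WithZero.exp (-(i : ℤ))) :
    ∃ k : ℤ, 2 * k = -(i : ℤ) ∧ Valued.v τ = WithZero.exp k := by
  have hτ0 : τ ≠ 0 := by
    rintro rfl
    rw [map_zero, map_zero] at hτA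
    exact (WithZero.exp_ne_zero hτA.symm)
  rw [val_algebraMap_eq_exp_two_mul_log v w h2 hϖ hπ hram hτ0] at hτA
  have := WithZero.exp_injective hτA
  have h0 : Valued.v τ ≠ 0 := (Valuation.ne_zero_iff _).mpr hτ0
  exact ⟨WithZero.log (Valued.v τ), this, (WithZero.exp_log h0).symm⟩

/-! ### The one-step descent for `n ≥ i` -/

/-- ONE STEP (`n ≥ i`): every `y ∈ U_F^{(n)}` is `z · y'` with `z` a norm and `y' ∈ U_F^{(n + 1)}`. -/
theorem exists_mem_normGroup_mul_inv_mem (h2 : Module.finrank (v.adicCompletion K) (w.adicCompletion L) = 2)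
    {ϖ : v.adicCompletionIntegers K} (hϖ : Irreducible ϖ) {π : w.adicCompletionIntegers L} (hπ : Irreducible π)
    (hram : ¬ Irreducible (algebraMap (v.adicCompletionIntegers K) (w.adicCompletionIntegers L) ϖ))
    (σ : (w.adicCompletion L) ≃ₐ[v.adicCompletion K] (w.adicCompletion L)) (hσ : σ ≠ 1)
    {i : ℕ} (hi : Valued.v (σ (π : w.adicCompletion L) - π) = WithZero.exp (-(i : ℤ)))
    (e : ℕ) (he : Valued.v (2 : v.adicCompletion K) = WithZero.exp (-(e : ℤ)))
    {n : ℕ} (hn : i ≤ n) {y : (v.adicCompletion K)ˣ} (hy : y ∈ unitFiltration v ϖ n) :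
    ∃ z ∈ T5AdicCompletionNormGroup.normGroup v w σ, y * z⁻¹ ∈ unitFiltration v ϖ (n + 1) := by
  obtain ⟨τ, hτ⟩ := exists_algebraMap_eq_add_algEquiv v w h2 σ hσ (π : w.adicCompletion L)
  obtain ⟨ν, hν⟩ := exists_algebraMap_eq_mul_algEquiv v w h2 σ hσ (π : w.adicCompletion L)
  have hνval := val_norm_uniformizer v w h2 hϖ hπ hram σ hν
  have hy1 : Valued.v (y : v.adicCompletion K) = 1 :=
    (mem_unitFiltration_zero_iff v ϖ y).mp (unitFiltration_antitone v ϖ (Nat.zero_le n) hy)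
  have ha : Valued.v ((y : v.adicCompletion K) - 1) ≤ WithZero.exp (-(n : ℤ)) :=
    val_sub_one_le_of_mem_unitFiltration v hϖ hy
  rcases break_cases v w h2 hϖ hπ hram σ hτ hi e he with ⟨hτA, -⟩ | ⟨hiB, -⟩
  · -- Case A: `x = alg (a / τ) · π`
    obtain ⟨k, hk, hτval⟩ := exists_val_trace_eq v w h2 hϖ hπ hram hτA
    have hτ0 : τ ≠ 0 := by
      rintro rfl
      rw [map_zero] at hτval
      exact (WithZero.exp_ne_zero hτval.symm)
    refine exists_mem_normGroup_mul_inv_mem_of_eq v w σ hϖ (((y : v.adicCompletion K) - 1) / τ) π hτ hν y hy1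
      (by rw [div_mul_cancel₀ _ hτ0]) ?_
    rw [map_mul, map_pow, map_div₀, hτval, hνval]
    calc (Valued.v ((y : v.adicCompletion K) - 1) / WithZero.exp k) ^ 2 * WithZero.exp (-1)
        ≤ (WithZero.exp (-(n : ℤ)) / WithZero.exp k) ^ 2 * WithZero.exp (-1) := by
          gcongr
          exact zero_le
      _ = WithZero.exp (2 * (-(n : ℤ) - k) + -1) := by
          rw [← WithZero.exp_sub, ← WithZero.exp_nsmul, ← WithZero.exp_add]
          congr 1
      _ ≤ WithZero.exp (-((n + 1 : ℕ) : ℤ)) := by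
          rw [WithZero.exp_le_exp]
          push_cast
          omega
  · -- Case B: `x = alg (a / 2)`, `z₀ = 1`
    have h2ne : (2 : v.adicCompletion K) ≠ 0 := by
      intro h
      rw [h, map_zero] at he
      exact (WithZero.exp_ne_zero he.symm)
    have hτ1 : algebraMap (v.adicCompletion K) (w.adicCompletion L) 2 = (1 : w.adicCompletion L) + σ 1 := by
      rw [map_one, map_ofNat]
      norm_num
    have hν1 : algebraMap (v.adicCompletion K) (w.adicCompletion L) 1 = (1 : w.adicCompletion L) * σ 1 := by
      rw [map_one, map_one, mul_one]
    refine exists_mem_normGroup_mul_inv_mem_of_eq v w σ hϖ (((y : v.adicCompletion K) - 1) / 2) 1 hτ1 hν1 y hy1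
      (by rw [div_mul_cancel₀ _ h2ne]) ?_
    rw [mul_one, map_pow, map_div₀, he]
    calc (Valued.v ((y : v.adicCompletion K) - 1) / WithZero.exp (-(e : ℤ))) ^ 2
        ≤ (WithZero.exp (-(n : ℤ)) / WithZero.exp (-(e : ℤ))) ^ 2 := by
          gcongr
          exact zero_le
      _ = WithZero.exp (2 * (-(n : ℤ) - -(e : ℤ))) := by
          rw [← WithZero.exp_sub, ← WithZero.exp_nsmul]
          congr 1
      _ ≤ WithZero.exp (-((n + 1 : ℕ) : ℤ)) := by
          rw [WithZero.exp_le_exp]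
          push_cast
          omega

/-! ### Descent to level `2e + 1` and the bound `f ≤ i` -/

/-- THE DESCENT: `U_F^{(n)} ⊆ N(L_w^×)` for every `n ≥ i`. -/
theorem unitFiltration_le_normGroup_of_le (h2 : Module.finrank (v.adicCompletion K) (w.adicCompletion L) = 2)
    {ϖ : v.adicCompletionIntegers K} (hϖ : Irreducible ϖ) {π : w.adicCompletionIntegers L} (hπ : Irreducible π)
    (hram : ¬ Irreducible (algebraMap (v.adicCompletionIntegers K) (w.adicCompletionIntegers L) ϖ))
    (σ : (w.adicCompletion L) ≃ₐ[v.adicCompletion K] (w.adicCompletion L)) (hσ : σ ≠ 1)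
    {i : ℕ} (hi : Valued.v (σ (π : w.adicCompletion L) - π) = WithZero.exp (-(i : ℤ)))
    {n : ℕ} (hn : i ≤ n) :
    unitFiltration v ϖ n ≤ T5AdicCompletionNormGroup.normGroup v w σ := by
  obtain ⟨e, he⟩ := exists_val_two_eq v
  -- induction on the distance `d` to level `2e + 1`
  suffices H : ∀ d n, i ≤ n → 2 * e + 1 ≤ n + d →
      unitFiltration v ϖ n ≤ T5AdicCompletionNormGroup.normGroup v w σ from
    H (2 * e + 1) n hn (by omega)
  intro d
  induction d with
  | zero =>
    intro n hn hd
    exact unitFiltration_le_normGroup_of_two_mul_add_one_le v w hϖ σ e he (by omega)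
  | succ d ih =>
    intro n hn hd
    by_cases hcase : 2 * e + 1 ≤ n + d
    · exact ih n hn hcase
    · intro y hy
      obtain ⟨z, hz, hyz⟩ := exists_mem_normGroup_mul_inv_mem v w h2 hϖ hπ hram σ hσ hi e he hn hy
      have hyz' : y * z⁻¹ ∈ T5AdicCompletionNormGroup.normGroup v w σ :=
        ih (n + 1) (by omega) (by omega) hyz
      have : y = y * z⁻¹ * z := by group
      rw [this]
      exact Subgroup.mul_mem _ hyz' hz

/-- **`f(η_v) ≤ i`**: the conductor exponent of the norm character is at most the break exponent. -/
theorem normCharConductor_le_break (h2 : Module.finrank (v.adicCompletion K) (w.adicCompletion L) = 2)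
    {ϖ : v.adicCompletionIntegers K} (hϖ : Irreducible ϖ) {π : w.adicCompletionIntegers L} (hπ : Irreducible π)
    (hram : ¬ Irreducible (algebraMap (v.adicCompletionIntegers K) (w.adicCompletionIntegers L) ϖ))
    (σ : (w.adicCompletion L) ≃ₐ[v.adicCompletion K] (w.adicCompletion L)) (hσ : σ ≠ 1)
    {i : ℕ} (hi : Valued.v (σ (π : w.adicCompletion L) - π) = WithZero.exp (-(i : ℤ)))
    (hind : (T5AdicCompletionNormGroup.normGroup v w σ).index = 2) :
    normCharConductor v w σ ϖ hind ≤ i := by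
  apply normCharConductor_le_of_le_ker
  intro y hy
  rw [MonoidHom.mem_ker, T5LocalNormCharacter.normChar_eq_one_iff]
  exact unitFiltration_le_normGroup_of_le v w h2 hϖ hπ hram σ hσ hi le_rfl hy

end Ramified

end

end Summit.Ventures.HodgeRepro2.T5RamifiedNormAbove
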